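import Literature.NumberTheory.GaloisRepresentations.CubicResidueSymbol
import HarnessLib

/-!
# Twisted point counts of the Picard curve `y³ = f(x)` over `𝓞 K ⧸ 𝔭` as cubic character sums

Topic `Literature/NumberTheory/GaloisRepresentations`.  Let `K ∋ ζ` (a primitive cube root of unity in
`𝓞 K`), `𝔭 ∤ 3` a finite place, `k = 𝓞 K ⧸ 𝔭`, `q = N𝔭`, `χ = χ_𝔭` the cubic residue symbol
(`CubicResidueSymbol`: `χ(b) ∈ {1, ζ, ζ²}`, `χ(b) ≡ b^{(q-1)/3}`, `χ(0) = 0`) and `f̄ = f mod 𝔭` for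
`f ∈ ℤ[X]`.  For `i < 3` put `n_i = #{a ∈ k : f̄(a) ≠ 0, f̄(a)^{(q-1)/3} ≡ ζ^i} = #{a : χ(f̄(a)) = ζ^i}`
and `r = #{a ∈ k : f̄(a) = 0}`.  We prove (`picard_twistedCount_eq_characterSum`)

  `q - r - 3 n_i = ζ^{2i} · a_𝔭(f) + ζ^i · a_𝔭(f²)`   in `𝓞 K`,

where `a_𝔭(f) = picardTrace f 𝔭 = -Σ_a χ(f̄(a))` and `a_𝔭(f²) = -Σ_a χ(f̄(a))²` is its conjugate sum.
By the fixed-place count of `SuperellipticTwistedFixedPlaces` the left side is `q + 1 - #Fix(φ ∘ δ_{ζ^i})`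
for the `q`-Frobenius `φ` twisted by the deck transformation `y ↦ ζ^i y` of `y³ = f̄(x)`, i.e. (Lefschetz)
the trace of `φ ∘ δ^i` on the Tate module: these three traces separate the two eigenspaces of `δ` and
identify the trace of Frobenius on the `λ`-adic representation of the Picard curve with `a_𝔭(f)`
(`PicardCurveGaloisRep`).  The identity is elementary: pointwise in `b = f̄(a)`,
`1 - [b = 0] - 3·[χ(b) = ζ^i] = -(ζ^{2i} χ(b) + ζ^i χ(b)²)` (`one_sub_ite_sub_three_mul_ite_eq`), because
for cube roots of unity `μ ≠ ν` one has `μ²ν + μν² = -1`.  Everything is proved; no named facts.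

## References
* K. Ireland, M. Rosen, *A Classical Introduction to Modern Number Theory* (1982), Ch. 8 §1 and Ch. 9 §3
  (cubic residue character, `N(y³ = a) = 1 + χ(a) + χ(a)²`). [IrelandRosen1982]
* R.-P. Holzapfel, *The Ball and Some Hilbert Problems* (1995), and C. Upton (2009): the Frobenius traces
  of Picard curves as cubic character sums. [Upton2009]
-/

noncomputable section

open Polynomial NumberField IsDedekindDomain

namespace Literature.NumberTheory.GaloisRepresentations

variable {K : Type*} [Field K] [NumberField K] {ζ : 𝓞 K} (hζ : IsPrimitiveRoot ζ 3)
include hζ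

omit hζ in
/-- For two distinct cube roots of unity `μ ≠ ν` in `𝓞 K`: `μ²ν + μν² = -1`
(`μ² + μν + ν² = 0` from `μ³ = ν³`, times `μ + ν`). [folklore] -/
theorem sq_mul_add_mul_sq_of_pow_three_eq_one {μ ν : 𝓞 K} (hμ : μ ^ 3 = 1) (hν : ν ^ 3 = 1) (hne : μ ≠ ν) :
    μ ^ 2 * ν + μ * ν ^ 2 = -1 := by
  have h1 : (μ - ν) * (μ ^ 2 + μ * ν + ν ^ 2) = 0 := by linear_combination hμ - hν
  have h2 : μ ^ 2 + μ * ν + ν ^ 2 = 0 := (mul_eq_zero.1 h1).resolve_left (sub_ne_zero.2 hne)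
  have h4 : (2 : 𝓞 K) * (μ ^ 2 * ν + μ * ν ^ 2 + 1) = 0 := by linear_combination (μ + ν) * h2 - hμ - hν
  have h5 : μ ^ 2 * ν + μ * ν ^ 2 + 1 = 0 := (mul_eq_zero.1 h4).resolve_left two_ne_zero
  linear_combination h5

/-- **The pointwise identity.**  For `𝔭 ∤ 3`, `b ∈ 𝓞 K ⧸ 𝔭` and `i < 3`:
`1 - [b = 0] - 3·[b ≠ 0 ∧ ζ^i ≡ b^{(q-1)/3}] = -(ζ^{2i} χ_𝔭(b) + ζ^i χ_𝔭(b)²)`. [folklore] -/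
theorem one_sub_ite_sub_three_mul_ite_eq {𝔭 : HeightOneSpectrum (𝓞 K)} (h3 : (3 : 𝓞 K) ∉ 𝔭.asIdeal)
    (b : 𝓞 K ⧸ 𝔭.asIdeal) {i : ℕ} (hi : i < 3)
    [Decidable (b = 0)] [Decidable (b ≠ 0 ∧ Ideal.Quotient.mk 𝔭.asIdeal (ζ ^ i) = b ^ ((𝔭.residueCard - 1) / 3))] :
    (1 : 𝓞 K) - (if b = 0 then 1 else 0)
        - 3 * (if b ≠ 0 ∧ Ideal.Quotient.mk 𝔭.asIdeal (ζ ^ i) = b ^ ((𝔭.residueCard - 1) / 3) then 1 else 0) =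
      -((ζ ^ i) ^ 2 * cubicResidueSymbol 𝔭 b + ζ ^ i * cubicResidueSymbol 𝔭 b ^ 2) := by
  have hζ3 : ∀ n : ℕ, (ζ ^ n) ^ 3 = 1 := fun n => by
    rw [← pow_mul, mul_comm, pow_mul, hζ.pow_eq_one, one_pow]
  by_cases hb : b = 0
  · subst hb
    rw [if_pos rfl, if_neg (fun h => h.1 rfl), cubicResidueSymbol_zero_of_three_not_mem hζ h3]
    ring
  · obtain ⟨j, hj, hjb⟩ := exists_mk_pow_eq_pow_residueCard_sub_one_div_three hζ h3 hb
    rw [cubicResidueSymbol_eq_pow_of_mk_pow_eq hζ h3 hj hjb, if_neg hb]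
    have hiff : (b ≠ 0 ∧ Ideal.Quotient.mk 𝔭.asIdeal (ζ ^ i) = b ^ ((𝔭.residueCard - 1) / 3)) ↔ i = j := by
      rw [← hjb]
      constructor
      · rintro ⟨-, h⟩
        rw [map_pow, map_pow] at h
        exact (isPrimitiveRoot_mk_of_three_not_mem hζ h3).pow_inj hi hj h
      · rintro rfl
        exact ⟨hb, rfl⟩
    by_cases hij : i = j
    · subst hij
      rw [if_pos (hiff.2 rfl)]
      linear_combination (2 : 𝓞 K) * hζ3 i
    · rw [if_neg (mt hiff.1 hij)]
      have hne : ζ ^ i ≠ ζ ^ j := fun h => hij (hζ.pow_inj hi hj h)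
      linear_combination sq_mul_add_mul_sq_of_pow_three_eq_one (hζ3 i) (hζ3 j) hne

/-- **Twisted point counts as cubic character sums.**  For `𝔭 ∤ 3`, `f ∈ ℤ[X]`, `f̄ = f mod 𝔭`, `q = N𝔭`
and `i < 3`:
`q - #{a : f̄(a) = 0} - 3 · #{a : f̄(a) ≠ 0, ζ^i ≡ f̄(a)^{(q-1)/3}} = ζ^{2i} a_𝔭(f) + ζ^i a_𝔭(f²)`
in `𝓞 K` (`a_𝔭 = picardTrace`).  For `i = 0` this is the affine point count
`#{y³ = f̄(x)} = q - a_𝔭(f) - a_𝔭(f²)` of Ireland–Rosen Prop. 8.1.5 rearranged.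
[cite: IrelandRosen1982, Ch. 8 §1, Prop. 8.1.5] -/
theorem picard_twistedCount_eq_characterSum {𝔭 : HeightOneSpectrum (𝓞 K)} (h3 : (3 : 𝓞 K) ∉ 𝔭.asIdeal)
    [Fintype (𝓞 K ⧸ 𝔭.asIdeal)] [DecidableEq (𝓞 K ⧸ 𝔭.asIdeal)] (f : ℤ[X]) {i : ℕ} (hi : i < 3) :
    ((Fintype.card (𝓞 K ⧸ 𝔭.asIdeal) : 𝓞 K)
      - (Finset.univ.filter fun a : 𝓞 K ⧸ 𝔭.asIdeal =>
          (f.map ((Ideal.Quotient.mk 𝔭.asIdeal).comp (algebraMap ℤ (𝓞 K)))).eval a = 0).card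
      - 3 * (Finset.univ.filter fun a : 𝓞 K ⧸ 𝔭.asIdeal =>
          (f.map ((Ideal.Quotient.mk 𝔭.asIdeal).comp (algebraMap ℤ (𝓞 K)))).eval a ≠ 0 ∧
            Ideal.Quotient.mk 𝔭.asIdeal (ζ ^ i) =
              (f.map ((Ideal.Quotient.mk 𝔭.asIdeal).comp (algebraMap ℤ (𝓞 K)))).eval a ^ ((𝔭.residueCard - 1) / 3)).card) =
      (ζ ^ i) ^ 2 * picardTrace f 𝔭 + ζ ^ i * picardTrace (f ^ 2) 𝔭 := by
  classical
  set fb := f.map ((Ideal.Quotient.mk 𝔭.asIdeal).comp (algebraMap ℤ (𝓞 K))) with hfb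
  have hsq : (f ^ 2).map ((Ideal.Quotient.mk 𝔭.asIdeal).comp (algebraMap ℤ (𝓞 K))) = fb ^ 2 := by
    rw [Polynomial.map_pow]
  rw [picardTrace_eq_neg_sum, picardTrace_eq_neg_sum, hsq, ← Finset.card_univ, Finset.card_eq_sum_ones, Finset.card_filter,
    Finset.card_filter, Nat.cast_sum, Nat.cast_sum, Nat.cast_sum, mul_neg, mul_neg, Finset.mul_sum, Finset.mul_sum,
    Finset.mul_sum, ← neg_add, ← Finset.sum_add_distrib, ← Finset.sum_neg_distrib, ← Finset.sum_sub_distrib,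
    ← Finset.sum_sub_distrib]
  refine Finset.sum_congr rfl fun a _ => ?_
  push_cast
  rw [eval_pow, cubicResidueSymbol_sq hζ, one_sub_ite_sub_three_mul_ite_eq hζ h3 (fb.eval a) hi]

end Literature.NumberTheory.GaloisRepresentations

end
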